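import Literature.Analysis.UnboundedOperators.FourierSpectrumCalculus
import Literature.Analysis.UnboundedOperators.TrivialFourierSpectrum
import Literature.Analysis.UnboundedOperators.SpectralGapProofs
import Literature.Analysis.Distribution.SchwartzMultipliers
import HarnessLib

/-!
# Form bounds of the Hamiltonian versus the Fourier spectrum: discharge of
`hasGroundStateGap_hamiltonian_iff`

Topic `Literature/Analysis/UnboundedOperators`, proof companion of `FourierSpectrum.lean`, which
records the two one-parameter bridges between the operator language (Stone generator
`H = U.hamiltonian` of `U(t) = exp (itH)`, form bounds `LinearPMap.IsBoundedBelowOn`) and the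
distributional language of the spectral condition (`UnitaryRep.HasFourierSpectrumIn`: the Fourier
transforms of all matrix coefficients `a ↦ ⟪φ, U(a)ψ⟫` vanish off the energy set, Streater–Wightman
§2-6 (2-114) and §3-1):

* `hasPositiveEnergy_iff_hasFourierSpectrumIn_Ici`: `H ≥ 0 ↔` Fourier spectrum in `[0, ∞)`
  (discharged independently in `FourierSpectrumPositiveEnergy.lean`, via Bochner positivity);
* `hasGroundStateGap_hamiltonian_iff`: `H` self-adjoint, `H ≥ 0`, `HΩ = 0`, `H ≥ Δ` on `{Ω}ᗮ`
  `↔` `Ω` is the unique vacuum, `0 < Δ`, and the Fourier spectrum lies in `{0} ∪ [Δ, ∞)` —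
  discharged here (`hasGroundStateGap_hamiltonian_iff_holds`).

With the SNAG/spectral theorem both are immediate (`⟪φ, U(a)ψ⟫ = ∫ e^{iaλ} d⟪φ, E_λ ψ⟫`). Here the
gap statement (and, on the way, both directions of the positivity statement for arbitrary lower
bounds `c` and relative to `{Ω}ᗮ`) is **proved without any spectral theorem and without Bochner's
theorem**, through the Schwartz functional calculus
`h ↦ U[𝓕h] = ∫ 𝓕h(a) U(a) da` of `UnitaryGroupSmearing.lean` / `FourierSpectrumCalculus.lean`
(Arveson's spectral subspaces): for `x ∈ D(H)` and `y = U[𝓕h]x` one has the exact identity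
`⟪y, Hy⟫ - c⟪y, y⟫ = ⟪x, U[𝓕(h̄ (2πξ - c) h)]x⟫` and `⟪x, U[𝓕(q̄ q)]x⟫ = ‖U[𝓕q]x‖² ≥ 0`.

* (**form bound ⇒ spectrum**, `integral_fourier_smul_appReal_eq_zero_of_isBoundedBelowOn`) if
  `H ≥ c` on `D(H) ∩ {Ω}ᗮ` (`Ω` invariant) and `2πξ < c` on `supp g`, choose a temperate real `r`
  with `r²(c - 2πξ) = 1` near `supp g` and `h = r g`: then `h̄ (2πξ - c) h = -ḡ g`, so
  `0 ≤ ⟪y, (H - c) y⟫ = -‖U[𝓕g]ψ‖²`, i.e. `U[𝓕g]ψ = 0`, first for `ψ ∈ D(H) ∩ {Ω}ᗮ` and then on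
  `{Ω}ᗮ` by density;
* (**spectrum ⇒ form bound**, `le_re_inner_hamiltonian_of_integral_fourier_smul_appReal_eq_zero`)
  if `U[𝓕g]x = 0` whenever `2πξ < c` on `supp g`, smear `x` with an approximate identity
  `k_R = 𝓕g_R`, cut `g_R` off below `(c - δ)/2π` (this does not change `U[𝓕g_R]x`) and write
  `(2πξ - c + 3δ) |h|² = |q|²` with a temperate square root: `⟪y_R, (H - c + 3δ) y_R⟫ ≥ 0` with
  `y_R → x`, `H y_R → Hx`;
* (**vacuum splitting**, `integral_fourier_smul_appReal_eq_zero_of_hasFourierSpectrumIn`) under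
  the gap spectral condition, vectors smeared with `supp g ⊆ (-Δ/2π, Δ/2π)` have Fourier spectrum
  `{0}`, hence are invariant (`TrivialFourierSpectrum.lean`), hence multiples of the unique vacuum;
  so for `x ⊥ Ω` the hypothesis of the second bullet holds with `c = Δ`.

Stone's theorem (`isSelfAdjoint_hamiltonian_holds`), `ker H = invariant vectors`
(`invariantVectors_eq_kernel_hamiltonian`) and the simplicity of a gapped ground state
(`LinearPMap.HasFormGap.kernel_eq_span_holds`) supply the remaining conjuncts.

## References

* R. F. Streater, A. S. Wightman, *PCT, Spin and Statistics, and All That* (1964; Princeton 2000),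
  §2-6, (2-113)–(2-114) and the SNAG paragraph ("`S` is not in the energy–momentum spectrum iff
  `∫ da ρ(a) U(a,1) = 0` for all `ρ ∈ 𝒮` with `supp ρ̃ ⊆ S`"), §3-1 (spectral condition, (3-1)
  uniqueness of the vacuum). [StreaterWightman1964]
* M. Reed, B. Simon, *Methods of Modern Mathematical Physics I*, §VIII.3–4 (Stone's theorem,
  functional calculus). [ReedSimonI1980]
* W. Arveson, On groups of automorphisms of operator algebras, J. Funct. Anal. 15 (1974) 217–243.

## Design notes

* Theorems only; the discharge is literally `theorem X_holds : X`.
* Energies are compared through `2 * π * ξ` (Mathlib's Fourier kernel `e^{-2πi aξ}`), matching the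
  rescaling `ξ ↦ 2πξ` built into `HasFourierSpectrumIn`.
-/

noncomputable section

open Filter MeasureTheory Complex
open scoped InnerProductSpace Topology ComplexConjugate SchwartzMap FourierTransform

namespace Literature.Analysis.UnboundedOperators

namespace UnitaryRep

variable {H : Type*} [NormedAddCommGroup H] [InnerProductSpace ℂ H] [CompleteSpace H]

/-! ### Small Schwartz-space facts -/

/-- Conjugation does not change the topological support of a Schwartz function. [folklore] -/
theorem tsupport_eq_of_conj {g gc : 𝓢(ℝ, ℂ)} (h : ∀ x, gc x = conj (g x)) :
    tsupport (gc : ℝ → ℂ) = tsupport (g : ℝ → ℂ) := by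
  have : Function.support (gc : ℝ → ℂ) = Function.support (g : ℝ → ℂ) := by
    ext x
    simp only [Function.mem_support, ne_eq, h x, map_eq_zero]
  simp only [tsupport, this]

/-- Smearing is additive in a Schwartz kernel on the Fourier side:
`U[𝓕(g₀ + g₁)] = U[𝓕g₀] + U[𝓕g₁]`. [folklore] -/
theorem integral_fourier_add_smul_appReal (U : OneParameterUnitaryGroup H) (g₀ g₁ : 𝓢(ℝ, ℂ))
    (ψ : H) :
    ∫ a, (𝓕 (g₀ + g₁) : 𝓢(ℝ, ℂ)) a • U.appReal a ψ =
      (∫ a, (𝓕 g₀ : 𝓢(ℝ, ℂ)) a • U.appReal a ψ) + ∫ a, (𝓕 g₁ : 𝓢(ℝ, ℂ)) a • U.appReal a ψ := by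
  rw [← U.integral_add_smul_appReal (𝓕 g₀ : 𝓢(ℝ, ℂ)).integrable (𝓕 g₁ : 𝓢(ℝ, ℂ)).integrable]
  refine integral_congr_ae (Eventually.of_forall fun a => ?_)
  dsimp only
  rw [FourierTransform.fourier_add, add_apply]

/-- Splitting a Schwartz function with a temperate real cutoff: `g = θ g + (1 - θ) g`. [folklore] -/
theorem eq_smulLeftCLM_add_smulLeftCLM_one_sub (g : 𝓢(ℝ, ℂ)) {θ : ℝ → ℝ}
    (hθ : θ.HasTemperateGrowth) :
    g = SchwartzMap.smulLeftCLM ℂ θ g + SchwartzMap.smulLeftCLM ℂ (fun ξ => 1 - θ ξ) g := by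
  have hθ' : (fun ξ => 1 - θ ξ).HasTemperateGrowth := (Function.HasTemperateGrowth.const 1).sub hθ
  ext ξ
  rw [add_apply, SchwartzMap.smulLeftCLM_apply_apply hθ, SchwartzMap.smulLeftCLM_apply_apply hθ',
    ← add_smul, add_sub_cancel, one_smul]

/-! ### Form bound ⇒ vanishing of the Fourier spectrum below the bound -/

/-- **Form bound ⇒ spectrum, on the domain.** Let `Ω` be an invariant vector, `H ≥ c` in the form
sense on `D(H) ∩ {Ω}ᗮ`, `x ∈ D(H) ∩ {Ω}ᗮ`, and `g` a Schwartz function with `2πξ ≤ c - ε` on its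
support (`ε > 0`). Then `∫ 𝓕g(a) • U(a)x da = 0`. (With `h = r g`, `r² (c - 2πξ) = 1` near
`supp g`, and `y = U[𝓕h]x ∈ D(H) ∩ {Ω}ᗮ`:
`0 ≤ ⟪y, Hy⟫ - c‖y‖² = ⟪x, U[𝓕(h̄(2πξ - c)h)]x⟫ = -‖U[𝓕g]x‖²`.) Under SNAG this is "the spectral
measure of `x` lives in `[c, ∞)`" (Streater–Wightman §2-6, (2-114)).
[cite: StreaterWightman1964, §2-6 eq. (2-114)] -/
theorem integral_fourier_smul_appReal_eq_zero_of_isBoundedBelowOn_of_mem_domain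
    (U : OneParameterUnitaryGroup H) {Ω : H} (hΩ : Ω ∈ U.invariantVectors) {c : ℝ}
    (hbd : U.hamiltonian.IsBoundedBelowOn (ℂ ∙ Ω)ᗮ c) (x : U.hamiltonian.domain)
    (hx : ⟪Ω, (x : H)⟫_ℂ = 0) {g : 𝓢(ℝ, ℂ)} {ε : ℝ} (hε : 0 < ε)
    (hg : ∀ ξ ∈ tsupport (g : ℝ → ℂ), 2 * Real.pi * ξ ≤ c - ε) :
    ∫ a, (𝓕 g : 𝓢(ℝ, ℂ)) a • U.appReal a (x : H) = 0 := by
  -- the temperate multiplier `r` with `r² (c - 2πξ) = 1` where `2πξ ≤ c - ε`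
  obtain ⟨r, hr, hr2⟩ := Distribution.exists_hasTemperateGrowth_eq_rpow_of_le
    (ℓ := fun ξ : ℝ => c - 2 * Real.pi * ξ) (by fun_prop) hε (p := -(1 / 2 : ℝ)) (by norm_num)
  set h : 𝓢(ℝ, ℂ) := SchwartzMap.smulLeftCLM ℂ r g with hh_def
  obtain ⟨hc, hhc⟩ := exists_schwartz_conj h
  -- `y = U[𝓕h] x ∈ D(H) ∩ {Ω}ᗮ`
  obtain ⟨hy, -⟩ := U.hamiltonian_integral_fourier_smul_appReal h x
  have hyK : (∫ a, (𝓕 h : 𝓢(ℝ, ℂ)) a • U.appReal a (x : H)) ∈ (ℂ ∙ Ω)ᗮ := by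
    rw [Submodule.mem_orthogonal_singleton_iff_inner_right]
    exact U.inner_integral_smul_appReal_eq_zero_of_mem_invariantVectors
      (𝓕 h : 𝓢(ℝ, ℂ)).integrable hΩ hx
  have hgap := hbd ⟨_, hy⟩ hyK
  -- the key identity, with kernel `h̄ (2πξ - c) h = -(ḡ g)`
  have hKI := U.inner_hamiltonian_sub_eq hhc c x hy
  have htemp : (fun ξ : ℝ => 2 * Real.pi * ξ - c).HasTemperateGrowth := by fun_prop
  have hP : ∀ ξ, (SchwartzMap.smulLeftCLM ℂ (hc : ℝ → ℂ)
      (SchwartzMap.smulLeftCLM ℂ (fun ξ : ℝ => 2 * Real.pi * ξ - c) h)) ξ =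
        (-1 : ℂ) * (conj (g ξ) * g ξ) := by
    intro ξ
    rw [SchwartzMap.smulLeftCLM_apply_apply hc.hasTemperateGrowth,
      SchwartzMap.smulLeftCLM_apply_apply htemp, hhc ξ, hh_def,
      SchwartzMap.smulLeftCLM_apply_apply hr]
    by_cases hgξ : g ξ = 0
    · simp [hgξ]
    · have hξ : 2 * Real.pi * ξ ≤ c - ε := hg ξ (subset_tsupport _ hgξ)
      have hℓ : ε ≤ c - 2 * Real.pi * ξ := by linarith
      have hpos : 0 < c - 2 * Real.pi * ξ := by linarith
      have hrξ : r ξ = (Real.sqrt (c - 2 * Real.pi * ξ))⁻¹ := by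
        rw [hr2 ξ hℓ, Real.rpow_neg hpos.le, ← Real.sqrt_eq_rpow]
      have hr2' : r ξ ^ 2 * (c - 2 * Real.pi * ξ) = 1 := by
        rw [hrξ, inv_pow, Real.sq_sqrt hpos.le, inv_mul_cancel₀ hpos.ne']
      have hr2C : (r ξ : ℂ) ^ 2 * ((c : ℂ) - 2 * Real.pi * ξ) = 1 := by exact_mod_cast hr2'
      simp only [Complex.real_smul, smul_eq_mul, map_mul, Complex.conj_ofReal]
      push_cast
      linear_combination (-(conj (g ξ) * g ξ)) * hr2C
  have hsq := U.inner_integral_fourier_conj_mul_self (s := -1) hP (x : H)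
  rw [hsq] at hKI
  -- real parts: `c‖y‖² ≤ re ⟪y, Hy⟫ = c‖y‖² - ‖U[𝓕g]x‖²`
  set y : H := ∫ a, (𝓕 h : 𝓢(ℝ, ℂ)) a • U.appReal a (x : H) with hy_def
  set w : H := ∫ a, (𝓕 g : 𝓢(ℝ, ℂ)) a • U.appReal a (x : H) with hw_def
  have hyy : (⟪y, y⟫_ℂ).re = ‖y‖ ^ 2 := by
    rw [← RCLike.re_to_complex]
    exact inner_self_eq_norm_sq y
  have hww : (⟪w, w⟫_ℂ).re = ‖w‖ ^ 2 := by
    rw [← RCLike.re_to_complex]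
    exact inner_self_eq_norm_sq w
  have hre : RCLike.re ⟪y, U.hamiltonian ⟨y, hy⟩⟫_ℂ = c * ‖y‖ ^ 2 - ‖w‖ ^ 2 := by
    have h1 : ⟪y, U.hamiltonian ⟨y, hy⟩⟫_ℂ = (c : ℂ) * ⟪y, y⟫_ℂ - ⟪w, w⟫_ℂ := by
      linear_combination hKI
    rw [RCLike.re_to_complex, h1, Complex.sub_re, Complex.re_ofReal_mul, hyy, hww]
  have hgap' : c * ‖y‖ ^ 2 ≤ RCLike.re ⟪y, U.hamiltonian ⟨y, hy⟩⟫_ℂ := by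
    simpa only [Subtype.coe_mk] using hgap
  have hle : c * ‖y‖ ^ 2 ≤ c * ‖y‖ ^ 2 - ‖w‖ ^ 2 := by
    rw [hre] at hgap'
    exact hgap'
  have hw0 : ‖w‖ ^ 2 ≤ 0 := by linarith
  have : ‖w‖ = 0 := by nlinarith [norm_nonneg w]
  exact norm_eq_zero.mp this

/-- **Form bound ⇒ spectrum.** Let `Ω` be an invariant vector of the one-parameter unitary group
`U`, suppose `H ≥ c` in the form sense on `D(H) ∩ {Ω}ᗮ`, let `ψ ⊥ Ω` and let `g` be a Schwartz
function with `2πξ < c` on its support. Then `∫ 𝓕g(a) • U(a)ψ da = 0` — every matrix coefficient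
`a ↦ ⟪φ, U(a)ψ⟫` has distributional Fourier transform supported in `{2πξ ≥ c}`. (From the domain
version by density of `D(H) ∩ {Ω}ᗮ` in `{Ω}ᗮ` and boundedness of `U[𝓕g]`; the uniform margin
`2πξ ≤ c - ε` on `supp g` comes from closedness of the support.) No spectral theorem is used.
[cite: StreaterWightman1964, §2-6 eq. (2-114)] -/
theorem integral_fourier_smul_appReal_eq_zero_of_isBoundedBelowOn
    (U : OneParameterUnitaryGroup H) {Ω : H} (hΩ : Ω ∈ U.invariantVectors) {c : ℝ}
    (hbd : U.hamiltonian.IsBoundedBelowOn (ℂ ∙ Ω)ᗮ c) {ψ : H} (hψ : ⟪Ω, ψ⟫_ℂ = 0)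
    {g : 𝓢(ℝ, ℂ)} (hg : ∀ ξ ∈ tsupport (g : ℝ → ℂ), 2 * Real.pi * ξ < c) :
    ∫ a, (𝓕 g : 𝓢(ℝ, ℂ)) a • U.appReal a ψ = 0 := by
  -- a uniform margin below `c` on the (closed) support
  obtain ⟨ε, hε, hgε⟩ : ∃ ε, 0 < ε ∧ ∀ ξ ∈ tsupport (g : ℝ → ℂ), 2 * Real.pi * ξ ≤ c - ε := by
    have hnot : c / (2 * Real.pi) ∉ tsupport (g : ℝ → ℂ) := fun hmem => by
      have := hg _ hmem
      rw [mul_div_cancel₀ _ (ne_of_gt Real.two_pi_pos)] at this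
      exact lt_irrefl _ this
    obtain ⟨ρ, hρ, hball⟩ := Metric.isOpen_iff.mp (isClosed_tsupport _).isOpen_compl _ hnot
    refine ⟨2 * Real.pi * ρ, by positivity, fun ξ hξ => ?_⟩
    have hξc := hg ξ hξ
    have hfar : ρ ≤ dist ξ (c / (2 * Real.pi)) := by
      by_contra hlt
      exact hball (Metric.mem_ball.mpr (lt_of_not_ge hlt)) hξ
    have hnn : 0 ≤ c / (2 * Real.pi) - ξ := by
      rw [sub_nonneg, le_div_iff₀' Real.two_pi_pos]
      exact hξc.le
    rw [Real.dist_eq, abs_sub_comm, abs_of_nonneg hnn] at hfar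
    have := mul_le_mul_of_nonneg_left hfar Real.two_pi_pos.le
    rw [mul_sub, mul_div_cancel₀ _ (ne_of_gt Real.two_pi_pos)] at this
    linarith
  -- the zero set of the bounded operator `U[𝓕g]` is closed and contains `D(H) ∩ {Ω}ᗮ`
  have hclosed : IsClosed {η : H | ∫ a, (𝓕 g : 𝓢(ℝ, ℂ)) a • U.appReal a η = 0} :=
    isClosed_eq (U.continuous_integral_smul_appReal (𝓕 g : 𝓢(ℝ, ℂ)).integrable) continuous_const
  have hsub : {η : H | η ∈ (OneParameterGroup.generator U.toStrongContRepresentation).domain ∧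
      ⟪Ω, η⟫_ℂ = 0} ⊆ {η : H | ∫ a, (𝓕 g : 𝓢(ℝ, ℂ)) a • U.appReal a η = 0} :=
    fun η hη => U.integral_fourier_smul_appReal_eq_zero_of_isBoundedBelowOn_of_mem_domain hΩ hbd
      ⟨η, hη.1⟩ hη.2 hε hgε
  exact hclosed.closure_subset_iff.mpr hsub (U.mem_closure_generator_domain_inter_orthogonal hΩ hψ)

/-! ### Vanishing of the Fourier spectrum below the bound ⇒ form bound -/

/-- **Spectrum ⇒ form bound, for one smeared vector.** If `U[𝓕g]x = 0` for every Schwartz `g`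
with `2πξ < c` on `supp g` (`x ∈ D(H)`), then for every Schwartz kernel `k` and `δ > 0` the vector
`y = ∫ k(a) • U(a)x da ∈ D(H)` satisfies `(c - 3δ) ‖y‖² ≤ re ⟪y, Hy⟫`. (Write `k = 𝓕g_k`, cut
`g_k` off smoothly below `(c - δ)/2π` — which does not change `y` — and use
`⟪y, (H - (c - 3δ))y⟫ = ‖U[𝓕q]x‖² ≥ 0` with `q = √(2πξ - c + 3δ) · (cutoff) · g_k`, a Schwartz
function thanks to a temperate square root on `{2πξ ≥ c - 2δ}`.) [folklore] -/
theorem le_re_inner_hamiltonian_integral_smul_appReal (U : OneParameterUnitaryGroup H)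
    (x : U.hamiltonian.domain) {c : ℝ}
    (hx : ∀ g : 𝓢(ℝ, ℂ), (∀ ξ ∈ tsupport (g : ℝ → ℂ), 2 * Real.pi * ξ < c) →
      ∫ a, (𝓕 g : 𝓢(ℝ, ℂ)) a • U.appReal a (x : H) = 0)
    {δ : ℝ} (hδ : 0 < δ) (k : 𝓢(ℝ, ℂ))
    (hy : (∫ a, k a • U.appReal a (x : H)) ∈ U.hamiltonian.domain) :
    (c - 3 * δ) * ‖∫ a, k a • U.appReal a (x : H)‖ ^ 2 ≤
      RCLike.re ⟪∫ a, k a • U.appReal a (x : H), U.hamiltonian ⟨_, hy⟩⟫_ℂ := by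
  -- cutoff `θ` (`0` below `(c - 2δ)/2π`, `1` above `(c - δ)/2π`) and square root `m`
  have hab : (c - 2 * δ) / (2 * Real.pi) < (c - δ) / (2 * Real.pi) :=
    (div_lt_div_iff_of_pos_right Real.two_pi_pos).mpr (by linarith)
  obtain ⟨θ, hθ, -, -, hθ0, hθ1⟩ := Distribution.exists_hasTemperateGrowth_step hab
  have hθ' : (fun ξ => 1 - θ ξ).HasTemperateGrowth := (Function.HasTemperateGrowth.const 1).sub hθ
  obtain ⟨m, hm, hm2⟩ := Distribution.exists_hasTemperateGrowth_eq_rpow_of_le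
    (ℓ := fun ξ : ℝ => 2 * Real.pi * ξ - (c - 3 * δ)) (by fun_prop) hδ (p := (1 / 2 : ℝ))
    (by norm_num)
  -- `k = 𝓕 gk`, `gk = θ gk + (1 - θ) gk`, and the low part does not see `x`
  set gk : 𝓢(ℝ, ℂ) := 𝓕⁻ k with hgk_def
  have hkg : (𝓕 gk : 𝓢(ℝ, ℂ)) = k := FourierTransform.fourier_fourierInv_eq k
  set hcut : 𝓢(ℝ, ℂ) := SchwartzMap.smulLeftCLM ℂ θ gk with hhcut_def
  set g' : 𝓢(ℝ, ℂ) := SchwartzMap.smulLeftCLM ℂ (fun ξ => 1 - θ ξ) gk with hg'_def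
  have hsplit : gk = hcut + g' := eq_smulLeftCLM_add_smulLeftCLM_one_sub gk hθ
  have hlow : ∫ a, (𝓕 g' : 𝓢(ℝ, ℂ)) a • U.appReal a (x : H) = 0 := by
    refine hx g' fun ξ hξ => ?_
    have hξ' : ξ ∈ tsupport (fun ξ => 1 - θ ξ) :=
      (SchwartzMap.tsupport_smulLeftCLM_subset _ _ hξ).2
    have hmem : ξ ∈ Set.Iic ((c - δ) / (2 * Real.pi)) := by
      refine closure_minimal (fun ζ hζ => ?_) isClosed_Iic hξ'
      by_contra hlt
      exact hζ (by
        show 1 - θ ζ = 0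
        rw [hθ1 ζ (le_of_lt (lt_of_not_ge hlt)), sub_self])
    have hle : ξ ≤ (c - δ) / (2 * Real.pi) := hmem
    rw [le_div_iff₀' Real.two_pi_pos] at hle
    linarith
  have hyk : (∫ a, k a • U.appReal a (x : H)) =
      ∫ a, (𝓕 hcut : 𝓢(ℝ, ℂ)) a • U.appReal a (x : H) := by
    conv_lhs => rw [← hkg, hsplit]
    rw [integral_fourier_add_smul_appReal, hlow, add_zero]
  -- the key identity for `y = U[𝓕 hcut] x` with `c' = c - 3δ`, kernel `= |m hcut|²`
  obtain ⟨hcutc, hhcutc⟩ := exists_schwartz_conj hcut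
  obtain ⟨hy2, -⟩ := U.hamiltonian_integral_fourier_smul_appReal hcut x
  have hKI := U.inner_hamiltonian_sub_eq hhcutc (c - 3 * δ) x hy2
  have htemp : (fun ξ : ℝ => 2 * Real.pi * ξ - (c - 3 * δ)).HasTemperateGrowth := by fun_prop
  have hP : ∀ ξ, (SchwartzMap.smulLeftCLM ℂ (hcutc : ℝ → ℂ)
      (SchwartzMap.smulLeftCLM ℂ (fun ξ : ℝ => 2 * Real.pi * ξ - (c - 3 * δ)) hcut)) ξ =
        (1 : ℂ) * (conj (SchwartzMap.smulLeftCLM ℂ m hcut ξ) *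
          SchwartzMap.smulLeftCLM ℂ m hcut ξ) := by
    intro ξ
    rw [SchwartzMap.smulLeftCLM_apply_apply hcutc.hasTemperateGrowth,
      SchwartzMap.smulLeftCLM_apply_apply htemp, hhcutc ξ,
      SchwartzMap.smulLeftCLM_apply_apply hm]
    by_cases hkξ : hcut ξ = 0
    · simp [hkξ]
    · -- on the support of `hcut` the cutoff is nonzero, so `2πξ > c - 2δ`, `m² = 2πξ - c + 3δ`
      have hθξ : θ ξ ≠ 0 := by
        intro h0
        apply hkξ
        rw [hhcut_def, SchwartzMap.smulLeftCLM_apply_apply hθ, h0, zero_smul]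
      have hξ : (c - 2 * δ) / (2 * Real.pi) < ξ := by
        by_contra hle
        exact hθξ (hθ0 ξ (le_of_not_gt hle))
      rw [div_lt_iff₀' Real.two_pi_pos] at hξ
      have hℓ : δ ≤ 2 * Real.pi * ξ - (c - 3 * δ) := by linarith
      have hnn : 0 ≤ 2 * Real.pi * ξ - (c - 3 * δ) := hδ.le.trans hℓ
      have hmξ : m ξ = Real.sqrt (2 * Real.pi * ξ - (c - 3 * δ)) := by
        rw [hm2 ξ hℓ, ← Real.sqrt_eq_rpow]
      have hm2' : m ξ ^ 2 = 2 * Real.pi * ξ - (c - 3 * δ) := by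
        rw [hmξ, Real.sq_sqrt hnn]
      have hm2C : (m ξ : ℂ) ^ 2 = 2 * Real.pi * ξ - ((c : ℂ) - 3 * δ) := by exact_mod_cast hm2'
      simp only [Complex.real_smul, smul_eq_mul, map_mul, Complex.conj_ofReal]
      push_cast
      linear_combination (-(conj (hcut ξ) * hcut ξ)) * hm2C
  have hsq := U.inner_integral_fourier_conj_mul_self (s := 1) hP (x : H)
  rw [hsq, one_mul] at hKI
  -- conclude on real parts
  set y : H := ∫ a, (𝓕 hcut : 𝓢(ℝ, ℂ)) a • U.appReal a (x : H) with hy_def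
  set w : H := ∫ a, (𝓕 (SchwartzMap.smulLeftCLM ℂ m hcut) : 𝓢(ℝ, ℂ)) a • U.appReal a (x : H)
    with hw_def
  have hyy : (⟪y, y⟫_ℂ).re = ‖y‖ ^ 2 := by
    rw [← RCLike.re_to_complex]
    exact inner_self_eq_norm_sq y
  have hww : (⟪w, w⟫_ℂ).re = ‖w‖ ^ 2 := by
    rw [← RCLike.re_to_complex]
    exact inner_self_eq_norm_sq w
  have hre : RCLike.re ⟪y, U.hamiltonian ⟨y, hy2⟩⟫_ℂ = (c - 3 * δ) * ‖y‖ ^ 2 + ‖w‖ ^ 2 := by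
    have h1 : ⟪y, U.hamiltonian ⟨y, hy2⟩⟫_ℂ = ((c - 3 * δ : ℝ) : ℂ) * ⟪y, y⟫_ℂ + ⟪w, w⟫_ℂ := by
      linear_combination hKI
    rw [RCLike.re_to_complex, h1, Complex.add_re, Complex.re_ofReal_mul, hyy, hww]
  -- transport from `⟨y, hy2⟩` to the given vector `⟨∫ k • U x, hy⟩`
  have hvec : (⟨∫ a, k a • U.appReal a (x : H), hy⟩ : U.hamiltonian.domain) = ⟨y, hy2⟩ :=
    Subtype.ext hyk
  rw [hvec, hyk, hre]
  nlinarith [sq_nonneg ‖w‖]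

/-- **Spectrum ⇒ form bound.** If `x ∈ D(H)` and `∫ 𝓕g(a) • U(a)x da = 0` for every Schwartz `g`
with `2πξ < c` on `supp g` (the distributional Fourier transforms of the matrix coefficients of
`x` live in `{2πξ ≥ c}`), then `c ‖x‖² ≤ re ⟪x, Hx⟫`. (Apply the previous lemma to the
approximate identities `R k(aR)`, `∫ k = 1`: `y_R → x` and `H y_R = U[k_R] Hx → Hx`; then let
`δ → 0`.) Under SNAG this is "`supp μ_x ⊆ [c, ∞) ⇒ ∫ λ dμ_x ≥ c ‖x‖²`"; no spectral theorem is
used. [cite: StreaterWightman1964, §2-6 eq. (2-114)] -/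
theorem le_re_inner_hamiltonian_of_integral_fourier_smul_appReal_eq_zero
    (U : OneParameterUnitaryGroup H) (x : U.hamiltonian.domain) {c : ℝ}
    (hx : ∀ g : 𝓢(ℝ, ℂ), (∀ ξ ∈ tsupport (g : ℝ → ℂ), 2 * Real.pi * ξ < c) →
      ∫ a, (𝓕 g : 𝓢(ℝ, ℂ)) a • U.appReal a (x : H) = 0) :
    c * ‖(x : H)‖ ^ 2 ≤ RCLike.re ⟪(x : H), U.hamiltonian x⟫_ℂ := by
  suffices hδ : ∀ δ : ℝ, 0 < δ → (c - 3 * δ) * ‖(x : H)‖ ^ 2 ≤ RCLike.re ⟪(x : H), U.hamiltonian x⟫_ℂ by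
    have ht : Tendsto (fun δ : ℝ => (c - 3 * δ) * ‖(x : H)‖ ^ 2) (𝓝[>] 0)
        (𝓝 (c * ‖(x : H)‖ ^ 2)) := by
      have hc : Continuous fun δ : ℝ => (c - 3 * δ) * ‖(x : H)‖ ^ 2 := by fun_prop
      have := hc.tendsto 0
      simp only [mul_zero, sub_zero] at this
      exact this.mono_left nhdsWithin_le_nhds
    exact le_of_tendsto ht (by
      filter_upwards [self_mem_nhdsWithin] with δ hδ' using hδ δ hδ')
  intro δ hδ
  obtain ⟨k, hk1⟩ := Distribution.exists_schwartz_integral_eq_one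
  -- the approximate identities and their limits
  set y : ℝ → H := fun R => ∫ a, ((R : ℂ) * k (a * R)) • U.appReal a (x : H) with hy_def
  set z : ℝ → H := fun R => ∫ a, ((R : ℂ) * k (a * R)) • U.appReal a (U.hamiltonian x)
    with hz_def
  have hy_lim : Tendsto y atTop (𝓝 (x : H)) := by
    have := U.tendsto_integral_dilate_smul_appReal' k.integrable (x : H)
    rwa [hk1, one_smul] at this
  have hz_lim : Tendsto z atTop (𝓝 (U.hamiltonian x)) := by
    have := U.tendsto_integral_dilate_smul_appReal' k.integrable (U.hamiltonian x)
    rwa [hk1, one_smul] at this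
  -- the inequality for each `R > 0`
  have hyz : ∀ R : ℝ, 0 < R → (c - 3 * δ) * ‖y R‖ ^ 2 ≤ (⟪y R, z R⟫_ℂ).re := by
    intro R hR
    obtain ⟨kR, hkR⟩ := Distribution.exists_schwartz_dilate k hR.ne'
    have hker : (fun a : ℝ => (R : ℂ) * k (a * R)) = (kR : ℝ → ℂ) := funext fun a => (hkR a).symm
    have hyR : y R = ∫ a, kR a • U.appReal a (x : H) := by
      simp only [hy_def, ← hker]
    have hzR : z R = ∫ a, kR a • U.appReal a (U.hamiltonian x) := by
      simp only [hz_def, ← hker]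
    obtain ⟨hyd, hHy⟩ := U.hamiltonian_integral_smul_appReal kR.integrable x
    have hineq := U.le_re_inner_hamiltonian_integral_smul_appReal x hx hδ kR hyd
    rw [hHy, ← hyR, ← hzR, RCLike.re_to_complex] at hineq
    exact hineq
  have hlhs : Tendsto (fun R => (c - 3 * δ) * ‖y R‖ ^ 2) atTop
      (𝓝 ((c - 3 * δ) * ‖(x : H)‖ ^ 2)) :=
    (hy_lim.norm.pow 2).const_mul _
  have hrhs : Tendsto (fun R => (⟪y R, z R⟫_ℂ).re) atTop
      (𝓝 (⟪(x : H), U.hamiltonian x⟫_ℂ).re) :=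
    (Complex.continuous_re.tendsto _).comp (hy_lim.inner hz_lim)
  have := le_of_tendsto_of_tendsto hlhs hrhs (by
    filter_upwards [eventually_gt_atTop 0] with R hR using hyz R hR)
  rwa [RCLike.re_to_complex]

/-! ### Vacuum splitting under the gap spectral condition -/

/-- From the spectral condition to vanishing of smeared vectors: if `U` has Fourier spectrum in
`S` and `2πξ ∉ S` on `supp g`, then `∫ 𝓕g(a) • U(a)ψ da = 0` for all `ψ` (all matrix
coefficients of this vector vanish). [folklore] -/
theorem integral_fourier_smul_appReal_eq_zero_of_hasFourierSpectrumIn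
    (U : OneParameterUnitaryGroup H) {S : Set ℝ} (hFS : U.HasFourierSpectrumIn S) (ψ : H)
    {g : 𝓢(ℝ, ℂ)} (hg : ∀ ξ ∈ tsupport (g : ℝ → ℂ), 2 * Real.pi * ξ ∉ S) :
    ∫ a, (𝓕 g : 𝓢(ℝ, ℂ)) a • U.appReal a ψ = 0 := by
  refine U.integral_fourier_smul_appReal_eq_zero_of_forall_fourierMatrixCoeff fun φ => ?_
  refine hFS φ ψ g fun ξ hξ => ?_
  simpa [smul_eq_mul] using hg ξ hξ

/-- **Vacuum splitting.** Suppose the one-parameter unitary group `U` has Fourier spectrum in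
`{0} ∪ [Δ, ∞)` with `0 < Δ`, and its invariant vectors are the multiples of `Ω`. Then for `x ⊥ Ω`
and every Schwartz `g` with `2πξ < Δ` on `supp g`, `∫ 𝓕g(a) • U(a)x da = 0`: split `g = θg + (1-θ)g`
with a bump `θ` around `0`; `U[𝓕((1-θ)g)] = 0` by the spectral condition, while every vector in the
range of `U[𝓕(θg)]* = U[𝓕(θ̄g)]` has Fourier spectrum `{0}`, hence is invariant
(`mem_invariantVectors_of_isVanishingOn`), hence a multiple of `Ω ⊥ x` — Streater–Wightman's
"the vacuum is the only normalizable eigenfunction of `P⁰`" (end of §2-6) in the one-parameter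
setting. [cite: StreaterWightman1964, §2-6 and §3-1 eq. (3-1)] -/
theorem integral_fourier_smul_appReal_eq_zero_of_hasFourierSpectrumIn_of_inner_eq_zero
    (U : OneParameterUnitaryGroup H) {Ω : H} (huniq : U.invariantVectors = ℂ ∙ Ω) {Δ : ℝ}
    (hΔ : 0 < Δ) (hFS : U.HasFourierSpectrumIn ({0} ∪ Set.Ici Δ)) {x : H} (hx : ⟪Ω, x⟫_ℂ = 0)
    {g : 𝓢(ℝ, ℂ)} (hg : ∀ ξ ∈ tsupport (g : ℝ → ℂ), 2 * Real.pi * ξ < Δ) :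
    ∫ a, (𝓕 g : 𝓢(ℝ, ℂ)) a • U.appReal a x = 0 := by
  -- a bump `θ = 1` on `[-σ, σ]`, supported in `[-2σ, 2σ]`, with `2π · 2σ < Δ`
  set σ : ℝ := Δ / (8 * Real.pi) with hσ_def
  have hσ : 0 < σ := by positivity
  have h2σ : 2 * Real.pi * (2 * σ) < Δ := by
    have : 2 * Real.pi * (2 * σ) = Δ / 2 := by
      rw [hσ_def]
      field_simp
      ring
    rw [this]
    linarith
  obtain ⟨θ, hθ, -, -, hθ1, hθsupp⟩ := Distribution.exists_hasTemperateGrowth_bump hσ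
  have hθ' : (fun ξ => 1 - θ ξ).HasTemperateGrowth := (Function.HasTemperateGrowth.const 1).sub hθ
  set g₀ : 𝓢(ℝ, ℂ) := SchwartzMap.smulLeftCLM ℂ θ g with hg₀_def
  set g₁ : 𝓢(ℝ, ℂ) := SchwartzMap.smulLeftCLM ℂ (fun ξ => 1 - θ ξ) g with hg₁_def
  have hsplit : g = g₀ + g₁ := eq_smulLeftCLM_add_smulLeftCLM_one_sub g hθ
  -- (1) the part away from `0` is killed by the spectral condition
  have h1 : ∫ a, (𝓕 g₁ : 𝓢(ℝ, ℂ)) a • U.appReal a x = 0 := by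
    refine U.integral_fourier_smul_appReal_eq_zero_of_hasFourierSpectrumIn hFS x fun ξ hξ => ?_
    have hξg : ξ ∈ tsupport (g : ℝ → ℂ) := (SchwartzMap.tsupport_smulLeftCLM_subset _ _ hξ).1
    have hξθ : ξ ∈ tsupport (fun ξ => 1 - θ ξ) := (SchwartzMap.tsupport_smulLeftCLM_subset _ _ hξ).2
    have hmem : ξ ∈ {ζ : ℝ | σ ≤ |ζ|} := by
      refine closure_minimal (fun ζ hζ => ?_) (isClosed_le continuous_const continuous_abs) hξθ
      by_contra hlt
      exact hζ (by
        show 1 - θ ζ = 0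
        rw [hθ1 ζ (le_of_lt (lt_of_not_ge hlt)), sub_self])
    have hσξ : σ ≤ |ξ| := hmem
    have hlt := hg ξ hξg
    rintro (h0 | hge)
    · have : ξ = 0 := by
        have h0' : 2 * Real.pi * ξ = 0 := h0
        rcases mul_eq_zero.mp h0' with h | h
        · exact absurd h (ne_of_gt Real.two_pi_pos)
        · exact h
      rw [this, abs_zero] at hσξ
      exact absurd hσξ (not_le.mpr hσ)
    · exact absurd (Set.mem_Ici.mp hge) (not_le.mpr hlt)
  -- (2) the part near `0`: its adjoint range consists of invariant vectors
  have h0 : ∫ a, (𝓕 g₀ : 𝓢(ℝ, ℂ)) a • U.appReal a x = 0 := by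
    obtain ⟨g₀c, hg₀c⟩ := exists_schwartz_conj g₀
    have hsupp₀ : tsupport (g₀c : ℝ → ℂ) ⊆ Set.Icc (-(2 * σ)) (2 * σ) := by
      rw [tsupport_eq_of_conj hg₀c]
      exact fun ξ hξ => hθsupp ((SchwartzMap.tsupport_smulLeftCLM_subset _ _ hξ).2)
    have hzero : ∀ w : H, ⟪∫ a, (𝓕 g₀ : 𝓢(ℝ, ℂ)) a • U.appReal a x, w⟫_ℂ = 0 := by
      intro w
      rw [U.inner_integral_smul_appReal_left (𝓕 g₀ : 𝓢(ℝ, ℂ)).integrable]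
      simp_rw [show ∀ a : ℝ, conj ((𝓕 g₀ : 𝓢(ℝ, ℂ)) (-a)) = (𝓕 g₀c : 𝓢(ℝ, ℂ)) a from
        fun a => (fourier_schwartz_conj hg₀c a).symm]
      set v : H := ∫ a, (𝓕 g₀c : 𝓢(ℝ, ℂ)) a • U.appReal a w with hv_def
      have hv : v ∈ U.invariantVectors := by
        apply mem_invariantVectors_of_isVanishingOn
        intro φ u hu
        rw [fourierMatrixCoeff_eq_inner, hv_def,
          U.integral_smul_appReal_integral_smul_appReal (𝓕 u : 𝓢(ℝ, ℂ)).integrable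
            (𝓕 g₀c : 𝓢(ℝ, ℂ)).integrable]
        simp_rw [integral_fourier_mul_fourier_sub u g₀c]
        rw [← fourierMatrixCoeff_eq_inner]
        refine hFS φ w _ fun ξ hξ => ?_
        have hξu : ξ ∈ tsupport (u : ℝ → ℂ) := (SchwartzMap.tsupport_smulLeftCLM_subset _ _ hξ).2
        have hξ0 : ξ ∈ Set.Icc (-(2 * σ)) (2 * σ) :=
          hsupp₀ ((SchwartzMap.tsupport_smulLeftCLM_subset _ _ hξ).1)
        have hne : ξ ≠ 0 := fun h => hu hξu h
        simp only [Set.mem_compl_iff, Set.mem_preimage, smul_eq_mul, Set.mem_union,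
          Set.mem_singleton_iff, Set.mem_Ici, not_or, not_le]
        refine ⟨?_, ?_⟩
        · exact mul_ne_zero (ne_of_gt Real.two_pi_pos) hne
        · have : |ξ| ≤ 2 * σ := abs_le.mpr ⟨hξ0.1, hξ0.2⟩
          calc 2 * Real.pi * ξ ≤ 2 * Real.pi * |ξ| :=
                mul_le_mul_of_nonneg_left (le_abs_self ξ) Real.two_pi_pos.le
            _ ≤ 2 * Real.pi * (2 * σ) := mul_le_mul_of_nonneg_left this Real.two_pi_pos.le
            _ < Δ := h2σ
      rw [huniq, Submodule.mem_span_singleton] at hv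
      obtain ⟨α, hα⟩ := hv
      rw [← hα, inner_smul_right, ← inner_conj_symm, hx, map_zero, mul_zero]
    rw [← @inner_self_eq_zero ℂ]
    exact hzero _
  rw [hsplit, integral_fourier_add_smul_appReal, h0, h1, add_zero]

/-! ### The discharge -/

/-- **`hasGroundStateGap_hamiltonian_iff` holds** (Streater–Wightman §3-1 in one dimension: the
spectral condition with a mass gap). For a one-parameter unitary group `U(t) = exp (itH)`:
`H` is self-adjoint, `H ≥ 0`, `Ω ≠ 0`, `HΩ = 0`, `0 < Δ` and `H ≥ Δ` on `D(H) ∩ {Ω}ᗮ`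
**iff** `Ω` is the unique vacuum of `U`, `0 < Δ`, and every Fourier-transformed matrix
coefficient of `U` vanishes off `{2πξ ∈ {0} ∪ [Δ, ∞)}`.
`→`: `Ω ∈ ker H =` invariant vectors, simple by `LinearPMap.HasFormGap.kernel_eq_span`; the
spectrum statement is "form bound ⇒ spectrum" on `{Ω}ᗮ` plus `U(a)Ω = Ω`, `∫ 𝓕g = g(0) = 0`.
`←`: Stone's theorem (`isSelfAdjoint_hamiltonian_holds`), invariant vectors `⊆ ker H`,
"spectrum ⇒ form bound" with `c = 0` (positivity) and with `c = Δ` on `{Ω}ᗮ` after vacuum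
splitting. No spectral theorem is used. [cite: StreaterWightman1964, §3-1 (spectral condition, (3-1))] -/
theorem hasGroundStateGap_hamiltonian_iff_holds : hasGroundStateGap_hamiltonian_iff (H := H) := by
  intro U Ω Δ
  constructor
  · rintro ⟨-, hpos, hΩ0, ⟨hΩd, hHΩ⟩, hΔ, hbd⟩
    have hΩker : Ω ∈ U.hamiltonian.kernel := LinearPMap.mem_kernel_iff.mpr ⟨hΩd, hHΩ⟩
    have hΩinv : Ω ∈ U.invariantVectors := U.kernel_hamiltonian_le_invariantVectors hΩker
    refine ⟨⟨⟨hΩinv, hΩ0⟩, ?_⟩, hΔ, fun φ ψ g hg => ?_⟩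
    · rw [invariantVectors_eq_kernel_hamiltonian]
      exact LinearPMap.HasFormGap.kernel_eq_span_holds ⟨hpos, hΩ0, ⟨hΩd, hHΩ⟩, hΔ, hbd⟩
    · -- support facts: `0 ∉ supp g` and `2πξ < Δ` on `supp g`
      have hg0 : g 0 = 0 := by
        refine image_eq_zero_of_notMem_tsupport fun h0 => ?_
        have := hg h0
        simp at this
      have hgΔ : ∀ ξ ∈ tsupport (g : ℝ → ℂ), 2 * Real.pi * ξ < Δ := by
        intro ξ hξ
        have := hg hξ
        simp only [Set.mem_compl_iff, Set.mem_preimage, smul_eq_mul, Set.mem_union,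
          Set.mem_singleton_iff, Set.mem_Ici, not_or, not_le] at this
        exact this.2
      -- decompose `ψ = (ψ - αΩ) + αΩ` with `ψ - αΩ ⊥ Ω`
      set α : ℂ := ⟪Ω, ψ⟫_ℂ / ⟪Ω, Ω⟫_ℂ with hα_def
      have hΩΩ : ⟪Ω, Ω⟫_ℂ ≠ 0 := inner_self_ne_zero.mpr hΩ0
      have horth : ⟪Ω, ψ - α • Ω⟫_ℂ = 0 := by
        rw [inner_sub_right, inner_smul_right, hα_def, div_mul_cancel₀ _ hΩΩ, sub_self]
      have hK : ∫ a, (𝓕 g : 𝓢(ℝ, ℂ)) a • U.appReal a (ψ - α • Ω) = 0 :=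
        U.integral_fourier_smul_appReal_eq_zero_of_isBoundedBelowOn hΩinv hbd horth hgΔ
      have hvac : ∫ a, (𝓕 g : 𝓢(ℝ, ℂ)) a • U.appReal a Ω = 0 := by
        have : ∀ a, U.appReal a Ω = Ω := fun a =>
          (mem_invariantVectors_iff U Ω).mp hΩinv (Multiplicative.ofAdd a)
        simp_rw [this, integral_smul_const, integral_fourier_schwartz, hg0, zero_smul]
      rw [fourierMatrixCoeff_eq_inner, show ψ = (ψ - α • Ω) + α • Ω by abel,
        U.integral_smul_appReal_add (𝓕 g : 𝓢(ℝ, ℂ)).integrable, integral_smul_appReal_smul, hK,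
        hvac, smul_zero, add_zero, inner_zero_right]
  · rintro ⟨⟨⟨hΩinv, hΩ0⟩, huniq⟩, hΔ, hFS⟩
    have hΩker : Ω ∈ U.hamiltonian.kernel := U.invariantVectors_le_kernel_hamiltonian hΩinv
    obtain ⟨hΩd, hHΩ⟩ := LinearPMap.mem_kernel_iff.mp hΩker
    -- positivity: spectrum ⇒ form bound with `c = 0`
    have hpos : U.hamiltonian.IsPositive := by
      refine ⟨U.hamiltonian_isSymmetric, fun x => ?_⟩
      have hvan : ∀ g : 𝓢(ℝ, ℂ), (∀ ξ ∈ tsupport (g : ℝ → ℂ), 2 * Real.pi * ξ < 0) →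
          ∫ a, (𝓕 g : 𝓢(ℝ, ℂ)) a • U.appReal a (x : H) = 0 := by
        intro g hg
        refine U.integral_fourier_smul_appReal_eq_zero_of_hasFourierSpectrumIn hFS x ?_
        rintro ξ hξ (h0 | hge)
        · have hlt := hg ξ hξ
          rw [show (2 * Real.pi * ξ : ℝ) = 0 from h0] at hlt
          exact lt_irrefl _ hlt
        · exact absurd (Set.mem_Ici.mp hge) (not_le.mpr ((hg ξ hξ).trans hΔ))
      have := U.le_re_inner_hamiltonian_of_integral_fourier_smul_appReal_eq_zero x hvan
      simpa using this
    refine ⟨isSelfAdjoint_hamiltonian_holds U, hpos, hΩ0, ⟨hΩd, hHΩ⟩, hΔ, fun x hxK => ?_⟩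
    -- the gap: spectrum ⇒ form bound with `c = Δ` on `{Ω}ᗮ`, after vacuum splitting
    have hx : ⟪Ω, (x : H)⟫_ℂ = 0 := (Submodule.mem_orthogonal_singleton_iff_inner_right).mp hxK
    exact U.le_re_inner_hamiltonian_of_integral_fourier_smul_appReal_eq_zero x (c := Δ)
      fun g hg => U.integral_fourier_smul_appReal_eq_zero_of_hasFourierSpectrumIn_of_inner_eq_zero
        huniq hΔ hFS hx hg

end UnitaryRep

end Literature.Analysis.UnboundedOperators
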